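import Summits.Ventures.PercRepro.SixFourPLList

/-!
# PercRepro — C-025 at `(6,4)`, §22.12.5: every coarse profile satisfying the arithmetic constraints is in `LIST`
(p3, gen 9)

`SixFourPLList.lean` builds `LIST` by a bounded enumeration (`vecs` / `incFromVec` / `parts` / `parts2`).  For the
completeness claim of 22.12.5 — the profile of every plane-line solid is in the list — one needs the converse
direction of the enumeration: a tuple that satisfies the CONSTRAINTS (`4 ≤ p ≤ 7`, `inc_m = 0` for `m ≥ p`, the
pair identity `Σ C(m,2)·inc_m = C(p,2)`, `3 ≤ n`, `n + e ≤ 6`, `10 ≤ g ≤ 13`, class sizes non-increasing, `≥ 1`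
(skew) / `≥ 2` (meeting), `≤ 7 − n`, with the skew / meeting sum rules and `#{j : s_j = m} ≤ inc_m`) IS produced
by the enumeration.  `Constraints` states them; `mem_parts` / `mem_parts2` / `mem_vecs` are the completeness
lemmas of the three enumerators; **`mem_LIST_of_constraints`** puts them together, and `J15_pos_of_constraints`
is the finite check in the constraint form.
-/

namespace PercRepro.SixFour.PL

/-! ## The constraints of 22.12.5 -/

/-- The arithmetic constraints of 22.12.5 on a coarse profile (the class sizes listed in non-increasing order). -/
def Constraints (π : CProf) : Prop :=
  4 ≤ π.p ∧ π.p ≤ 7 ∧ 3 ≤ π.n ∧ π.n + e π ≤ 6 ∧ 10 ≤ π.p + π.n ∧ π.p + π.n ≤ 13 ∧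
  π.inc.length = 6 ∧ (∀ i, i < 6 → π.p ≤ i + 2 → π.inc.getD i 0 = 0) ∧
  ((List.range 6).map fun i => ch (i + 2) 2 * π.inc.getD i 0).sum = ch π.p 2 ∧
  π.sizes.Pairwise (· ≥ ·) ∧ (∀ s ∈ π.sizes, s ≤ 7 - π.n) ∧
  (if π.meet then (∀ s ∈ π.sizes, 2 ≤ s) ∧ (π.sizes.map fun s => s - 1).sum = π.p - 1
    else (∀ s ∈ π.sizes, 1 ≤ s) ∧ π.sizes.sum = π.p) ∧
  (∀ m, 2 ≤ m → m ≤ 7 → π.sizes.count m ≤ π.inc.getD (m - 2) 0)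

/-! ## Completeness of the three enumerators -/

/-- `parts` produces every non-increasing list of sizes `≥ 1`, `≤ mx`, of sum `rem` and length `≤ f`. -/
theorem mem_parts : ∀ (l : List ℕ) (f rem mx : ℕ), l.Pairwise (· ≥ ·) → (∀ s ∈ l, 1 ≤ s) →
    (∀ s ∈ l, s ≤ mx) → l.sum = rem → l.length ≤ f → l ∈ parts f rem mx
  | [], f, rem, mx, _, _, _, hsum, _ => by
    simp only [List.sum_nil] at hsum
    subst hsum
    cases f <;> simp [parts]
  | s :: l, f, rem, mx, hsort, hpos, hle, hsum, hlen => by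
    rw [List.pairwise_cons] at hsort
    simp only [List.sum_cons] at hsum
    simp only [List.length_cons] at hlen
    have hs1 : 1 ≤ s := hpos s (List.mem_cons_self ..)
    have hsmx : s ≤ mx := hle s (List.mem_cons_self ..)
    obtain ⟨rem', rfl⟩ : ∃ rem', rem = rem' + 1 := ⟨rem - 1, by omega⟩
    obtain ⟨f', rfl⟩ : ∃ f', f = f' + 1 := ⟨f - 1, by omega⟩
    simp only [parts, List.mem_flatMap, List.mem_range, List.mem_map]
    refine ⟨min (rem' + 1) mx - s, by omega, l, ?_, by congr 1; omega⟩
    have hmin : min (rem' + 1) mx - (min (rem' + 1) mx - s) = s := by omega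
    rw [hmin]
    exact mem_parts l f' (rem' + 1 - s) s hsort.2 (fun t ht => hpos t (List.mem_cons_of_mem _ ht))
      (fun t ht => hsort.1 t ht) (by omega) (by omega)

/-- `parts2` produces every non-increasing list of sizes `≥ 2`, `≤ mx`, with `Σ (s − 1) = rem` and length `≤ f`. -/
theorem mem_parts2 : ∀ (l : List ℕ) (f rem mx : ℕ), l.Pairwise (· ≥ ·) → (∀ s ∈ l, 2 ≤ s) →
    (∀ s ∈ l, s ≤ mx) → (l.map fun s => s - 1).sum = rem → l.length ≤ f → l ∈ parts2 f rem mx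
  | [], f, rem, mx, _, _, _, hsum, _ => by
    simp only [List.map_nil, List.sum_nil] at hsum
    subst hsum
    cases f <;> simp [parts2]
  | s :: l, f, rem, mx, hsort, hpos, hle, hsum, hlen => by
    rw [List.pairwise_cons] at hsort
    simp only [List.map_cons, List.sum_cons] at hsum
    simp only [List.length_cons] at hlen
    have hs2 : 2 ≤ s := hpos s (List.mem_cons_self ..)
    have hsmx : s ≤ mx := hle s (List.mem_cons_self ..)
    obtain ⟨rem', rfl⟩ : ∃ rem', rem = rem' + 1 := ⟨rem - 1, by omega⟩
    obtain ⟨f', rfl⟩ : ∃ f', f = f' + 1 := ⟨f - 1, by omega⟩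
    simp only [parts2, List.mem_flatMap, List.mem_range, List.mem_map]
    refine ⟨min (rem' + 2) mx - s, by omega, l, ?_, by congr 1; omega⟩
    have hmin : min (rem' + 2) mx - (min (rem' + 2) mx - s) = s := by omega
    rw [hmin]
    exact mem_parts2 l f' (rem' + 1 - (s - 1)) s hsort.2 (fun t ht => hpos t (List.mem_cons_of_mem _ ht))
      (fun t ht => hsort.1 t ht) (by omega) (by omega)

/-- `vecsAux p k m` produces every list of length `k` whose `i`-th entry is `≤ C(p,2)/C(m+i,2)`. -/
theorem mem_vecsAux (p : ℕ) : ∀ (l : List ℕ) (k m : ℕ), l.length = k →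
    (∀ i, i < l.length → l.getD i 0 ≤ ch p 2 / ch (m + i) 2) → l ∈ vecsAux p k m
  | [], k, m, hlen, _ => by
    simp only [List.length_nil] at hlen
    subst hlen
    simp [vecsAux]
  | v :: l, k, m, hlen, hbound => by
    simp only [List.length_cons] at hlen
    obtain ⟨k', rfl⟩ : ∃ k', k = k' + 1 := ⟨k - 1, by omega⟩
    simp only [vecsAux, List.mem_flatMap, List.mem_range, List.mem_map]
    refine ⟨v, ?_, l, ?_, rfl⟩
    · have := hbound 0 (by simp)
      simp only [List.getD_cons_zero, Nat.add_zero] at this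
      omega
    · refine mem_vecsAux p l k' (m + 1) (by omega) (fun i hi => ?_)
      have := hbound (i + 1) (by simp only [List.length_cons]; omega)
      simp only [List.getD_cons_succ] at this
      rw [show m + 1 + i = m + (i + 1) by omega]
      exact this

/-- A list `inc` of length `6` satisfying the constraints is `incFromVec p vec` for `vec = (inc₃, …, inc_{p−1})`. -/
theorem incFromVec_eq {p : ℕ} (hp4 : 4 ≤ p) (hp7 : p ≤ 7) {inc : List ℕ} (hlen : inc.length = 6)
    (hzero : ∀ i, i < 6 → p ≤ i + 2 → inc.getD i 0 = 0)
    (hsum : ((List.range 6).map fun i => ch (i + 2) 2 * inc.getD i 0).sum = ch p 2) :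
    incFromVec p ((inc.drop 1).take (p - 3)) = some inc := by
  obtain ⟨a, b, c, d, e', f', rfl⟩ : ∃ a b c d e f : ℕ, inc = [a, b, c, d, e, f] := by
    match inc, hlen with
    | [a, b, c, d, e, f], _ => exact ⟨a, b, c, d, e, f, rfl⟩
  have h2 : ch 2 2 = 1 := by decide
  have h3 : ch 3 2 = 3 := by decide
  have h4 : ch 4 2 = 6 := by decide
  have h5 : ch 5 2 = 10 := by decide
  have h6 : ch 6 2 = 15 := by decide
  have h7 : ch 7 2 = 21 := by decide
  have hc : p ≤ 4 → c = 0 := fun h => by simpa using hzero 2 (by norm_num) (by omega)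
  have hd : p ≤ 5 → d = 0 := fun h => by simpa using hzero 3 (by norm_num) (by omega)
  have he : p ≤ 6 → e' = 0 := fun h => by simpa using hzero 4 (by norm_num) (by omega)
  have hf : p ≤ 7 → f' = 0 := fun h => by simpa using hzero 5 (by norm_num) (by omega)
  simp [List.range_succ, h2, h3, h4, h5, h6, h7] at hsum
  interval_cases p
  · have := hc le_rfl; have := hd (by norm_num); have := he (by norm_num); have := hf (by norm_num)
    subst c d e' f'
    have hb : 3 * b ≤ 6 := by omega
    simp [incFromVec, List.range_succ, h3, h4, hb]
    omega
  · have := hd le_rfl; have := he (by norm_num); have := hf (by norm_num)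
    subst d e' f'
    have hb : 3 * b + 6 * c ≤ 10 := by omega
    simp [incFromVec, List.range_succ, h3, h4, h5, hb]
    omega
  · have := he le_rfl; have := hf (by norm_num)
    subst e' f'
    simp [incFromVec, List.range_succ, h3, h4, h5, h6]
    omega
  · have := hf le_rfl
    subst f'
    simp [incFromVec, List.range_succ, h3, h4, h5, h6, h7]
    omega

/-! ## Membership in the list -/

/-- The entry `i` of `(inc.drop 1).take k` is `inc_{i+1}` for `i < k`. -/
theorem getD_take_drop (inc : List ℕ) (k i : ℕ) (hi : i < k) :
    ((inc.drop 1).take k).getD i 0 = inc.getD (i + 1) 0 := by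
  rw [List.getD_eq_getElem?_getD, List.getD_eq_getElem?_getD, List.getElem?_take_of_lt hi,
    List.getElem?_drop, Nat.add_comm]

/-- A single term of the pair identity: `C(m,2)·inc_m ≤ C(p,2)`. -/
theorem term_le_of_sum {π : CProf} (hsum : ((List.range 6).map fun i => ch (i + 2) 2 * π.inc.getD i 0).sum = ch π.p 2)
    {i : ℕ} (hi : i < 6) : ch (i + 2) 2 * π.inc.getD i 0 ≤ ch π.p 2 := by
  rw [← hsum]
  apply List.single_le_sum (fun x _ => Nat.zero_le x)
  rw [List.mem_map]
  exact ⟨i, List.mem_range.2 hi, rfl⟩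

/-- `C(m, 2) > 0` for `m ≥ 2`. -/
theorem ch_two_pos {m : ℕ} (hm : 2 ≤ m) : 0 < ch m 2 := by
  unfold ch
  rw [if_pos hm]
  have h := Nat.choose_eq_factorial_div_factorial hm
  rw [← h]
  exact Nat.choose_pos hm

/-- **Completeness of the enumeration (22.12.5)**: every coarse profile satisfying `Constraints` is in `LIST`. -/
theorem mem_LIST_of_constraints {π : CProf} (h : Constraints π) : π ∈ LIST := by
  obtain ⟨hp4, hp7, hn3, hne, hg10, hg13, hlen, hzero, hsum, hsort, hcap, hcase, hcount⟩ := h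
  unfold LIST
  simp only [List.mem_flatMap, List.mem_range]
  refine ⟨π.p - 4, by omega, ?_⟩
  rw [show π.p - 4 + 4 = π.p by omega]
  refine ⟨(π.inc.drop 1).take (π.p - 3), ?_, ?_⟩
  · -- the line-size vector is produced by `vecs`
    unfold vecs
    apply mem_vecsAux
    · rw [List.length_take, List.length_drop, hlen]
      omega
    · intro i hi
      rw [List.length_take, List.length_drop, hlen] at hi
      have hi' : i < π.p - 3 := lt_of_lt_of_le hi (min_le_left _ _)
      rw [getD_take_drop _ _ _ hi']
      have hterm := term_le_of_sum hsum (show i + 1 < 6 by omega)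
      rw [show i + 1 + 2 = 3 + i by omega] at hterm
      rw [Nat.le_div_iff_mul_le (ch_two_pos (by omega))]
      rw [Nat.mul_comm]
      exact hterm
  · rw [incFromVec_eq hp4 hp7 hlen hzero hsum]
    simp only [List.mem_flatMap, List.mem_range, List.mem_cons, List.not_mem_nil, or_false]
    refine ⟨π.meet, by cases π.meet <;> simp, π.n - 3, by omega, ?_⟩
    rw [show π.n - 3 + 3 = π.n by omega]
    have hcond : 10 ≤ π.p + π.n ∧ π.p + π.n ≤ 13 ∧ π.n + (if π.meet then 1 else 0) ≤ 6 := by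
      refine ⟨hg10, hg13, ?_⟩
      unfold e at hne
      exact hne
    rw [if_pos hcond]
    simp only [List.mem_map, List.mem_filter, List.all_eq_true, List.mem_range, decide_eq_true_eq]
    refine ⟨π.sizes, ⟨?_, fun i hi => hcount (i + 2) (by omega) (by omega)⟩, rfl⟩
    cases hm : π.meet
    · -- skew
      rw [hm] at hcase
      simp only [Bool.false_eq_true, if_false] at hcase
      simp only [Bool.false_eq_true, if_false]
      apply mem_parts π.sizes π.p π.p (7 - π.n) hsort hcase.1 hcap hcase.2
      -- the length of a list of positive naturals is at most its sum
      rw [← hcase.2]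
      exact List.length_le_sum_of_one_le _ hcase.1
    · -- meeting
      rw [hm] at hcase
      simp only [if_true] at hcase
      simp only [if_true]
      apply mem_parts2 π.sizes π.p (π.p - 1) (7 - π.n) hsort hcase.1 hcap hcase.2
      calc π.sizes.length = (π.sizes.map fun s => s - 1).length := (List.length_map _).symm
        _ ≤ (π.sizes.map fun s => s - 1).sum := by
          apply List.length_le_sum_of_one_le
          intro t ht
          rw [List.mem_map] at ht
          obtain ⟨s, hs, rfl⟩ := ht
          have := hcase.1 s hs
          omega
        _ = π.p - 1 := hcase.2
        _ ≤ π.p := Nat.sub_le _ _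

/-- **The finite check in constraint form**: `0 < 15·Jlow(π)` for every profile satisfying `Constraints`. -/
theorem J15_pos_of_constraints {π : CProf} (h : Constraints π) : 0 < J15 π :=
  J15_pos_of_mem (mem_LIST_of_constraints h)

end PercRepro.SixFour.PL
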